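import Mathlib
import Summits.FinalStateConjecture.FinalStateConjecture.Theses.TwoBoundarySqueeze
import Summits.FinalStateConjecture.FinalStateConjecture.Theses.PhaseMixingCapture
import Literature.Geometry.Lorentzian.TameGenericityDiagonal
import Literature.Geometry.Lorentzian.TameGenericityLocal

/-!
# Line `censored-curves-split` — crux `GenericCensorshipThirdLaw` (stmt-FinalStateConjecture-17297;
# primary decl `GlobalAttraction.GenericCensorshipThirdLaw`, rank 3; shared verbatim by
# `TwoBoundarySqueeze.GenericCensorshipThirdLaw`, rank 4) — skeleton v2-noGA (interim: the `GlobalAttraction` import and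
# `GenericCensorshipThirdLaw_proof` / `_of'` for the primary decl are held back while the farm is incoherent on that module)
# (crux-strategist `cstrat-stmt-FinalStateConjecture-17297-r1`, 2026-08-17)

v2: stubs 2–3 are now VERBATIM the stubs `stub_thresholdTransversal` / `stub_censoredLanding` registered
for the sibling crux `GenericCensoredCapture` (stmt-FinalStateConjecture-17308,
`Cruxes/GenericCensoredCapture/Lines/birth.lean`, skeleton registrar 2026-08-17T02:46Z), so that ONE
obligation serves both cruxes (that skeleton records independently that its stubs 1–3 assemble to this
crux); stub 1 stays verbatim the shared ITEM stmt-FinalStateConjecture-17269. v1 (04:1xZ) had the same cut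
with the negated-universal spelling of the two hypotheses (`¬ ∀ …` instead of `∃ …, ¬ …`).

Crux (FIXED, concluded BY NAME in `GenericCensorshipThirdLaw_of'` / `GenericCensorshipThirdLaw_proof`
for the primary decl and in `GenericCensorshipThirdLaw_of` for the TwoBoundarySqueeze copy; the two copies
are the same proposition, `genericCensorshipThirdLaw_globalAttraction_iff : _ ↔ _ := Iff.rfl`):
`∀ X, IsTameChristodoulouGeneric (admissibleVacuumData X) P 1`,
`P D := ∀ MGHD 𝒟 of D, complete 𝓘⁺ ∧ (every HONEST C⁰ final state decomposition of 𝒟 — O = exteriorOf,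
RaysStayInClosure, HasExhaustiveCharts, IsFutureOriented — has only sub-extremal holes)`.

## The line = a TYPED DECOMPOSITION of the crux (BC2 redirect of the re-audit bin RESTATED)

Tame Christodoulou codimension is monotone in the exceptional set but NOT closed under conjunction
(`RobustClausewiseGenericity.PlanarNonClosure`), so `P = CENS ∧ THIRD` cannot be cut pointwise into
"generic censorship" and "generic third law". It CAN be cut ALONG CENSORED CURVES — the door
`InitialDataSet.isTameChristodoulouGeneric_of_relative` / `isTameChristodoulouGeneric_of_local`
(`Literature/Geometry/Lorentzian/TameGenericity{Diagonal,Local}.lean`; precedent: line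
`censorship-enters-diagonally` of crux `CaptureSufficesC2`, route PhaseMixingCapture). Three registered stubs:

* `stub_weakCosmicCensorshipTame` (Sub₁; verbatim the shared item stmt-FinalStateConjecture-17269
  `PhaseMixingCapture.WeakCosmicCensorshipTame`, see `stub_weakCosmicCensorshipTame_iff_item17269`):
  TAME weak cosmic censorship in MGHD form. Its role here: through a NON-censored exceptional datum it
  supplies a tame, immersed, injective admissible curve all of whose members off `0` are censored.
* `stub_thresholdTransversal` (Sub₂; censored base): through every CENSORED admissible datum one of whose
  MGHDs carries an honest C⁰ final state with a hole that is not sub-extremal passes a tame immersed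
  injective admissible curve whose members with `0 < ‖c‖ < ε` are GOOD (censored, every honest C⁰ final
  hole sub-extremal): the extremal threshold is a wall one leaves while staying censored (Kehle–Unger
  arXiv:2402.10190; Angelopoulos–Kehle–Unger arXiv:2410.16234 / 2603.10378).
* `stub_censoredLanding` (Sub₃; naked base, HARDEST): the censored witness curve through a datum with an
  MGHD of incomplete `𝓘⁺` is replaced by a tame immersed injective admissible curve through the same
  datum whose members with `0 < ‖c‖ < ε` are GOOD (joint transversality at naked data: the censored escape
  is tilted off the extremal stratum without losing censorship near the curve).

Composition (§4, sorry-free): at an exceptional admissible `d`, case on `CENS d`; censored ⇒ (classically)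
some MGHD carries an honest C⁰ final state with an extremal hole ⇒ Sub₂; not censored ⇒ some MGHD has
incomplete `𝓘⁺` and `d` is exceptional for Sub₁, whose witness has censored members off `0` (read off the
exceptional-set clause) ⇒ Sub₃; either LOCAL escape is globalised by the radial reparametrisation
(`isTameChristodoulouGeneric_of_local`). §5 records that no stub over-claims (Sub₂, Sub₃ ⟸ crux; Sub₁ ⟸
crux ∧ `MGHDExists`), i.e. given the route's rank-9 item the cut is LOSSLESS. No self-witness case arises
(only exceptional base data are ever fed to Sub₂/Sub₃), so nothing of the breathing package is needed.

Why each stub might fail (one line each; sources in the line card `Lines/censored-curves-split.md`):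
Sub₁ — weak cosmic censorship is open outside symmetry; vacuum naked singularities exist (RSR 2023).
Sub₂ — vacuum extremal-Kerr formation and the `C¹` wall structure of its threshold are unproved (AKU is
spherical EMSF); one-sided/Cantor accumulation of thresholds, loss of censorship along every transversal
curve, or `C⁰`-floppy Kerr labels break it. Sub₃ — needs censorship to persist near the given curve under
compactly supported tilts and the extremal stratum to be a wall there; fails if naked data are accumulated
by extremal-threshold data along every tame curve.

Disproof used: none exists for this crux (`ledger crux ls stmt-FinalStateConjecture-17297`: no
`Disproof.lean`, 2026-08-17). Dead lines: none registered.
-/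

-- the doubled `FinalStateConjecture.FinalStateConjecture` path component trips dupNamespace
set_option linter.dupNamespace false

noncomputable section

open scoped Manifold ContDiff Topology
open Set Function Filter

namespace Summit.FinalStateConjecture.FinalStateConjecture.Cruxes.GenericCensorshipThirdLaw.CensoredCurvesSplit

open Literature.Geometry.Lorentzian
open Summit.FinalStateConjecture.FinalStateConjecture.Theses.TwoBoundarySqueeze
  (GenericCensorshipThirdLaw MGHDExists)

/-! ## §1 The properties at a datum (short forms; each agrees definitionally with the expanded texts) -/
section Properties

variable {X : Type} [TopologicalSpace X] [ChartedSpace E3 X] [IsManifold (𝓡 3) ∞ X] [T2Space X]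
  [SecondCountableTopology X] [ConnectedSpace X]

/-- `CENS D` — every maximal vacuum Cauchy development of `D` has complete future null infinity
(sojourn form). [cite: Christodoulou1999, pp. A26–A27] -/
def CensoredProperty (D : InitialDataSet (𝓡 3) X) : Prop :=
  ∀ 𝒟 : VacuumCauchyDevelopment D, 𝒟.IsMaximal →
    Summit.FinalStateConjecture.HasCompleteNullInfinity 𝒟.toCauchyDevelopment

/-- `THIRD D` — the C⁰ third law at `D`: every HONEST `C⁰` final state decomposition of every MGHD of
`D` has only sub-extremal holes. [cite: KehleUnger2025, Thm. 1] -/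
def ThirdLawC0Property (D : InitialDataSet (𝓡 3) X) : Prop :=
  ∀ 𝒟 : VacuumCauchyDevelopment D, 𝒟.IsMaximal →
    ∀ (O : Set 𝒟.carrier) (dd : FinalStateDecomposition 𝒟.toSpacetime O 0),
      O = Summit.FinalStateConjecture.exteriorOf 𝒟.toCauchyDevelopment dd.charted →
        Summit.FinalStateConjecture.RaysStayInClosure 𝒟.toCauchyDevelopment O →
          Summit.FinalStateConjecture.HasExhaustiveCharts dd →
            Summit.FinalStateConjecture.IsFutureOriented dd →
              ∀ i, Kerr.IsSubextremal (dd.mass i) (dd.spin i)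

/-- `EXT D` — some MGHD of `D` carries an honest `C⁰` final state decomposition with a hole that is not
sub-extremal (hence exactly extremal, `|aᵢ| = Mᵢ`): the constructive negation of `THIRD D`. -/
def HasExtremalHonestEndpoint (D : InitialDataSet (𝓡 3) X) : Prop :=
  ∃ 𝒟 : VacuumCauchyDevelopment D, 𝒟.IsMaximal ∧
    ∃ (O : Set 𝒟.carrier) (d₀ : FinalStateDecomposition 𝒟.toSpacetime O 0),
      O = Summit.FinalStateConjecture.exteriorOf 𝒟.toCauchyDevelopment d₀.charted ∧
        Summit.FinalStateConjecture.RaysStayInClosure 𝒟.toCauchyDevelopment O ∧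
          Summit.FinalStateConjecture.HasExhaustiveCharts d₀ ∧
            Summit.FinalStateConjecture.IsFutureOriented d₀ ∧
              ∃ i, ¬ Kerr.IsSubextremal (d₀.mass i) (d₀.spin i)

/-- `P D` — the generic property of the crux at `D` (verbatim its matrix; "GOOD"). -/
def CruxProperty (D : InitialDataSet (𝓡 3) X) : Prop :=
  ∀ 𝒟 : VacuumCauchyDevelopment D, 𝒟.IsMaximal →
    Summit.FinalStateConjecture.HasCompleteNullInfinity 𝒟.toCauchyDevelopment ∧
      ∀ (O : Set 𝒟.carrier) (dd : FinalStateDecomposition 𝒟.toSpacetime O 0),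
        O = Summit.FinalStateConjecture.exteriorOf 𝒟.toCauchyDevelopment dd.charted →
          Summit.FinalStateConjecture.RaysStayInClosure 𝒟.toCauchyDevelopment O →
            Summit.FinalStateConjecture.HasExhaustiveCharts dd →
              Summit.FinalStateConjecture.IsFutureOriented dd →
                ∀ i, Kerr.IsSubextremal (dd.mass i) (dd.spin i)

omit [T2Space X] [SecondCountableTopology X] in
/-- `P = CENS ∧ THIRD` pointwise. [folklore] -/
theorem cruxProperty_iff (D : InitialDataSet (𝓡 3) X) :
    CruxProperty D ↔ CensoredProperty D ∧ ThirdLawC0Property D := by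
  constructor
  · intro h
    exact ⟨fun 𝒟 h𝒟 ↦ (h 𝒟 h𝒟).1, fun 𝒟 h𝒟 ↦ (h 𝒟 h𝒟).2⟩
  · rintro ⟨hC, hT⟩ 𝒟 h𝒟
    exact ⟨hC 𝒟 h𝒟, hT 𝒟 h𝒟⟩

omit [T2Space X] [SecondCountableTopology X] in
/-- `EXT D ↔ ¬ THIRD D` (classical). [folklore] -/
theorem hasExtremalHonestEndpoint_iff_not_thirdLaw (D : InitialDataSet (𝓡 3) X) :
    HasExtremalHonestEndpoint D ↔ ¬ ThirdLawC0Property D := by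
  constructor
  · rintro ⟨𝒟, h𝒟, O, d₀, hO, hR, hE, hF, i, hi⟩ hT
    exact hi (hT 𝒟 h𝒟 O d₀ hO hR hE hF i)
  · intro hT
    by_contra h
    apply hT
    intro 𝒟 h𝒟 O d₀ hO hR hE hF i
    by_contra hi
    exact h ⟨𝒟, h𝒟, O, d₀, hO, hR, hE, hF, i, hi⟩

omit [T2Space X] [SecondCountableTopology X] in
/-- A censored datum failing `P` has an extremal honest endpoint. [folklore] -/
theorem hasExtremalHonestEndpoint_of_censored_not_cruxProperty {D : InitialDataSet (𝓡 3) X}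
    (hC : CensoredProperty D) (hP : ¬ CruxProperty D) : HasExtremalHonestEndpoint D := by
  rw [hasExtremalHonestEndpoint_iff_not_thirdLaw]
  exact fun hT ↦ hP ((cruxProperty_iff D).2 ⟨hC, hT⟩)

omit [T2Space X] [SecondCountableTopology X] in
/-- A non-censored datum has an MGHD with incomplete `𝓘⁺` (classical). [folklore] -/
theorem exists_incomplete_of_not_censored {D : InitialDataSet (𝓡 3) X} (hC : ¬ CensoredProperty D) :
    ∃ 𝒟 : VacuumCauchyDevelopment D, 𝒟.IsMaximal ∧
      ¬ Summit.FinalStateConjecture.HasCompleteNullInfinity 𝒟.toCauchyDevelopment := by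
  by_contra h
  push Not at h
  exact hC h

/-- A `LOCAL P-ESCAPE THROUGH d` (the shape `isTameChristodoulouGeneric_of_local` consumes): an end, a
tame immersed injective admissible curve through `d`, and `ε > 0` below which the members off `0` satisfy
`P` — the common conclusion shape of Sub₂ and Sub₃. -/
def LocalEscape (d : InitialDataSet (𝓡 3) X) : Prop :=
  ∃ (e : AFEnd X) (F : EuclideanSpace ℝ (Fin 1) → InitialDataSet (𝓡 3) X),
    InitialDataSet.IsTameDataFamily e 1 F ∧ InitialDataSet.IsImmersedAtZero 1 F ∧ F 0 = d ∧
      Injective F ∧ (∀ c, F c ∈ admissibleVacuumData X) ∧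
        ∃ ε > (0 : ℝ), ∀ c, c ≠ 0 → ‖c‖ < ε → CruxProperty (F c)

end Properties

/-- The crux is tame genericity of `CruxProperty` (definitional read-back). [folklore] -/
theorem genericCensorshipThirdLaw_iff :
    GenericCensorshipThirdLaw ↔
      ∀ (X : Type) [TopologicalSpace X] [ChartedSpace E3 X] [IsManifold (𝓡 3) ∞ X] [T2Space X]
        [SecondCountableTopology X] [ConnectedSpace X],
        InitialDataSet.IsTameChristodoulouGeneric (admissibleVacuumData X) CruxProperty 1 :=
  Iff.rfl

/-! ## §2 Short forms of the three pieces -/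
section ShortForms

/-- Sub₁, short form: tame weak cosmic censorship in MGHD form. -/
def WeakCosmicCensorshipTame : Prop :=
  ∀ (X : Type) [TopologicalSpace X] [ChartedSpace E3 X] [IsManifold (𝓡 3) ∞ X] [T2Space X]
    [SecondCountableTopology X] [ConnectedSpace X],
    InitialDataSet.IsTameChristodoulouGeneric (admissibleVacuumData X)
      (fun D ↦ (∃ 𝒟 : VacuumCauchyDevelopment D, 𝒟.IsMaximal) ∧ CensoredProperty D) 1

/-- Sub₂, short form: local `P`-escape through every censored admissible datum with an extremal honest
endpoint. -/
def ThresholdTransversality : Prop :=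
  ∀ (X : Type) [TopologicalSpace X] [ChartedSpace E3 X] [IsManifold (𝓡 3) ∞ X] [T2Space X]
    [SecondCountableTopology X] [ConnectedSpace X],
    ∀ D ∈ admissibleVacuumData X, CensoredProperty D → HasExtremalHonestEndpoint D → LocalEscape D

/-- Sub₃, short form: local `P`-escape through the base of a censored tame immersed injective admissible
curve whose base has an MGHD with incomplete `𝓘⁺`. -/
def CensoredLanding : Prop :=
  ∀ (X : Type) [TopologicalSpace X] [ChartedSpace E3 X] [IsManifold (𝓡 3) ∞ X] [T2Space X]
    [SecondCountableTopology X] [ConnectedSpace X],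
    ∀ (e : AFEnd X) (F : EuclideanSpace ℝ (Fin 1) → InitialDataSet (𝓡 3) X),
      InitialDataSet.IsTameDataFamily e 1 F → InitialDataSet.IsImmersedAtZero 1 F → Injective F →
        (∀ c, F c ∈ admissibleVacuumData X) →
          (∃ 𝒟 : VacuumCauchyDevelopment (F 0), 𝒟.IsMaximal ∧
              ¬ Summit.FinalStateConjecture.HasCompleteNullInfinity 𝒟.toCauchyDevelopment) →
            (∀ c ≠ 0, CensoredProperty (F c)) → LocalEscape (F 0)

end ShortForms

/-! ### Statements of the registered stubs, under the stub names -/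
namespace Goal

/-- Statement of `stub_weakCosmicCensorshipTame`. -/
abbrev stub_weakCosmicCensorshipTame : Prop := WeakCosmicCensorshipTame
/-- Statement of `stub_thresholdTransversal`. -/
abbrev stub_thresholdTransversal : Prop := ThresholdTransversality
/-- Statement of `stub_censoredLanding`. -/
abbrev stub_censoredLanding : Prop := CensoredLanding

end Goal

/-! ## §3 Registered stubs (the only `sorry`s of the file), stated EXPANDED over importable declarations
(`TameGenericity.lean`, `FinalState.lean`, `Statement.lean`) — verbatim the `statement` fields of the
prepared split `children.json`; stubs 2–3 moreover BYTE-IDENTICAL with the stubs of the same names in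
`Cruxes/GenericCensoredCapture/Lines/birth.lean` — so that `--supports` files, the sibling skeleton and the
route-level split state them without importing this module. Each IS its short form of §2 definitionally
(`*_iff`, by `Iff.rfl`). -/

/-- **Stub 1 `stub_weakCosmicCensorshipTame` — TAME WEAK COSMIC CENSORSHIP (MGHD form)** — verbatim the
shared item stmt-FinalStateConjecture-17269 (`PhaseMixingCapture.WeakCosmicCensorshipTame`). For every
connected Hausdorff second-countable smooth `3`-manifold `X`, tame-Christodoulou-generically in
`admissibleVacuumData X` a maximal vacuum Cauchy development exists and every MGHD has complete `𝓘⁺`.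
Open-problem-sized (Christodoulou's weak cosmic censorship); hypothesis-grade for this line.
[cite: Christodoulou1999, p. A24] -/
theorem stub_weakCosmicCensorshipTame :
    ∀ (X : Type) [TopologicalSpace X] [ChartedSpace Literature.Geometry.Lorentzian.E3 X] [IsManifold (𝓡 3) ((⊤ : ℕ∞) : WithTop ℕ∞) X] [T2Space X] [SecondCountableTopology X] [ConnectedSpace X], Literature.Geometry.Lorentzian.InitialDataSet.IsTameChristodoulouGeneric (Literature.Geometry.Lorentzian.admissibleVacuumData X) (fun D ↦ (∃ 𝒟 : Literature.Geometry.Lorentzian.VacuumCauchyDevelopment D, 𝒟.IsMaximal) ∧ ∀ 𝒟 : Literature.Geometry.Lorentzian.VacuumCauchyDevelopment D, 𝒟.IsMaximal → Summit.FinalStateConjecture.HasCompleteNullInfinity 𝒟.toCauchyDevelopment) 1 := by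
  sorry

/-- **Stub 2 `stub_thresholdTransversal` — TRANSVERSALITY OF THE CENSORED EXTREMAL THRESHOLD (local in the
parameter).** Through every censored admissible datum one of whose MGHDs carries an honest `C⁰` final state
decomposition with a hole that is not sub-extremal passes a tame, immersed, injective admissible curve whose
members with `0 < ‖c‖ < ε` are censored with only sub-extremal honest `C⁰` final holes.
[cite: KehleUnger2024, Thm. 1] [cite: AngelopoulosKehleUnger2026, Thm. 2] -/
theorem stub_thresholdTransversal :
    ∀ (X : Type) [TopologicalSpace X] [ChartedSpace Literature.Geometry.Lorentzian.E3 X] [IsManifold (𝓡 3) (⊤ : ℕ∞) X] [T2Space X] [SecondCountableTopology X] [ConnectedSpace X], ∀ D ∈ Literature.Geometry.Lorentzian.admissibleVacuumData X, (∀ 𝒟 : Literature.Geometry.Lorentzian.VacuumCauchyDevelopment D, 𝒟.IsMaximal → Summit.FinalStateConjecture.HasCompleteNullInfinity 𝒟.toCauchyDevelopment) → (∃ 𝒟 : Literature.Geometry.Lorentzian.VacuumCauchyDevelopment D, 𝒟.IsMaximal ∧ ∃ (O : Set 𝒟.carrier) (d₀ : Literature.Geometry.Lorentzian.FinalStateDecomposition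 𝒟.toSpacetime O 0), O = Summit.FinalStateConjecture.exteriorOf 𝒟.toCauchyDevelopment d₀.charted ∧ Summit.FinalStateConjecture.RaysStayInClosure 𝒟.toCauchyDevelopment O ∧ Summit.FinalStateConjecture.HasExhaustiveCharts d₀ ∧ Summit.FinalStateConjecture.IsFutureOriented d₀ ∧ ∃ i, ¬ Literature.Geometry.Lorentzian.Kerr.IsSubextremal (d₀.mass i) (d₀.spin i)) → ∃ (e : Literature.Geometry.Lorentzian.AFEnd X) (F : EuclideanSpace ℝ (Fin 1) → Literature.Geometry.Lorentzian.InitialDataSet (𝓡 3) X), Literature.Geometry.Lorentzian.InitialDataSet.IsTameDataFamily e 1 F ∧ Literature.Geometry.Lorentzian.InitialDataSet.IsImmersedAtZero 1 F ∧ F 0 = D ∧ Function.Injective F ∧ (∀ c, F c ∈ Literature.Geometry.Lorentzian.admissibleVacuumData X) ∧ ∃ ε > (0 : ℝ), ∀ c, c ≠ 0 → ‖c‖ < ε → ∀ 𝒟 : Literature.Geometry.Lorentzian.VacuumCauchyDevelopment (F c), 𝒟.IsMaximal → Summit.FinalStateConjecture.HasCompleteNullInfinity 𝒟.toCauchyDevelopment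 ∧ ∀ (O : Set 𝒟.carrier) (d : Literature.Geometry.Lorentzian.FinalStateDecomposition 𝒟.toSpacetime O 0), O = Summit.FinalStateConjecture.exteriorOf 𝒟.toCauchyDevelopment d.charted → Summit.FinalStateConjecture.RaysStayInClosure 𝒟.toCauchyDevelopment O → Summit.FinalStateConjecture.HasExhaustiveCharts d → Summit.FinalStateConjecture.IsFutureOriented d → ∀ i, Literature.Geometry.Lorentzian.Kerr.IsSubextremal (d.mass i) (d.spin i) := by
  sorry

/-- **Stub 3 `stub_censoredLanding` — LANDING OFF THE THRESHOLD ALONG CENSORED CURVES (relative, local in the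
parameter; HARDEST).** Every tame, immersed, injective admissible curve whose base datum has an MGHD with
incomplete `𝓘⁺` and whose members off `0` are censored can be replaced by a tame, immersed, injective
admissible curve through the same datum whose members with `0 < ‖c‖ < ε` are censored with only
sub-extremal honest `C⁰` final holes. [cite: Christodoulou1999instability, Thm. 4.1] [cite: KehleUnger2024, Thm. 1] -/
theorem stub_censoredLanding :
    ∀ (X : Type) [TopologicalSpace X] [ChartedSpace Literature.Geometry.Lorentzian.E3 X] [IsManifold (𝓡 3) (⊤ : ℕ∞) X] [T2Space X] [SecondCountableTopology X] [ConnectedSpace X], ∀ (e : Literature.Geometry.Lorentzian.AFEnd X) (F : EuclideanSpace ℝ (Fin 1) → Literature.Geometry.Lorentzian.InitialDataSet (𝓡 3) X), Literature.Geometry.Lorentzian.InitialDataSet.IsTameDataFamily e 1 F → Literature.Geometry.Lorentzian.InitialDataSet.IsImmersedAtZero 1 F → Function.Injective F → (∀ c, F c ∈ Literature.Geometry.Lorentzian.admissibleVacuumData X) → (∃ 𝒟 : Literature.Geometry.Lorentzian.VacuumCauchyDevelopment (F 0), 𝒟.IsMaximal ∧ ¬ Summit.FinalStateConjecture.HasCompleteNullInfinity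 𝒟.toCauchyDevelopment) → (∀ c ≠ 0, ∀ 𝒟 : Literature.Geometry.Lorentzian.VacuumCauchyDevelopment (F c), 𝒟.IsMaximal → Summit.FinalStateConjecture.HasCompleteNullInfinity 𝒟.toCauchyDevelopment) → ∃ (e' : Literature.Geometry.Lorentzian.AFEnd X) (F' : EuclideanSpace ℝ (Fin 1) → Literature.Geometry.Lorentzian.InitialDataSet (𝓡 3) X), Literature.Geometry.Lorentzian.InitialDataSet.IsTameDataFamily e' 1 F' ∧ Literature.Geometry.Lorentzian.InitialDataSet.IsImmersedAtZero 1 F' ∧ F' 0 = F 0 ∧ Function.Injective F' ∧ (∀ c, F' c ∈ Literature.Geometry.Lorentzian.admissibleVacuumData X) ∧ ∃ ε > (0 : ℝ), ∀ c, c ≠ 0 → ‖c‖ < ε → ∀ 𝒟 : Literature.Geometry.Lorentzian.VacuumCauchyDevelopment (F' c), 𝒟.IsMaximal → Summit.FinalStateConjecture.HasCompleteNullInfinity 𝒟.toCauchyDevelopment ∧ ∀ (O : Set 𝒟.carrier) (d : Literature.Geometry.Lorentzian.FinalStateDecomposition 𝒟.toSpacetime O 0), O = Summit.FinalStateConjecture.exteriorOf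 𝒟.toCauchyDevelopment d.charted → Summit.FinalStateConjecture.RaysStayInClosure 𝒟.toCauchyDevelopment O → Summit.FinalStateConjecture.HasExhaustiveCharts d → Summit.FinalStateConjecture.IsFutureOriented d → ∀ i, Literature.Geometry.Lorentzian.Kerr.IsSubextremal (d.mass i) (d.spin i) := by
  sorry

/-- Stub 1 IS its short form. [folklore] -/
theorem stub_weakCosmicCensorshipTame_iff :
    Goal.stub_weakCosmicCensorshipTame ↔
      ∀ (X : Type) [TopologicalSpace X] [ChartedSpace Literature.Geometry.Lorentzian.E3 X] [IsManifold (𝓡 3) ((⊤ : ℕ∞) : WithTop ℕ∞) X] [T2Space X] [SecondCountableTopology X] [ConnectedSpace X], Literature.Geometry.Lorentzian.InitialDataSet.IsTameChristodoulouGeneric (Literature.Geometry.Lorentzian.admissibleVacuumData X) (fun D ↦ (∃ 𝒟 : Literature.Geometry.Lorentzian.VacuumCauchyDevelopment D, 𝒟.IsMaximal) ∧ ∀ 𝒟 : Literature.Geometry.Lorentzian.VacuumCauchyDevelopment D, 𝒟.IsMaximal → Summit.FinalStateConjecture.HasCompleteNullInfinity 𝒟.toCauchyDevelopment) 1 :=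
  Iff.rfl

/-- Stub 2 IS its short form. [folklore] -/
theorem stub_thresholdTransversal_iff :
    Goal.stub_thresholdTransversal ↔
      ∀ (X : Type) [TopologicalSpace X] [ChartedSpace Literature.Geometry.Lorentzian.E3 X] [IsManifold (𝓡 3) (⊤ : ℕ∞) X] [T2Space X] [SecondCountableTopology X] [ConnectedSpace X], ∀ D ∈ Literature.Geometry.Lorentzian.admissibleVacuumData X, (∀ 𝒟 : Literature.Geometry.Lorentzian.VacuumCauchyDevelopment D, 𝒟.IsMaximal → Summit.FinalStateConjecture.HasCompleteNullInfinity 𝒟.toCauchyDevelopment) → (∃ 𝒟 : Literature.Geometry.Lorentzian.VacuumCauchyDevelopment D, 𝒟.IsMaximal ∧ ∃ (O : Set 𝒟.carrier) (d₀ : Literature.Geometry.Lorentzian.FinalStateDecomposition 𝒟.toSpacetime O 0), O = Summit.FinalStateConjecture.exteriorOf 𝒟.toCauchyDevelopment d₀.charted ∧ Summit.FinalStateConjecture.RaysStayInClosure 𝒟.toCauchyDevelopment O ∧ Summit.FinalStateConjecture.HasExhaustiveCharts d₀ ∧ Summit.FinalStateConjecture.IsFutureOriented d₀ ∧ ∃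 i, ¬ Literature.Geometry.Lorentzian.Kerr.IsSubextremal (d₀.mass i) (d₀.spin i)) → ∃ (e : Literature.Geometry.Lorentzian.AFEnd X) (F : EuclideanSpace ℝ (Fin 1) → Literature.Geometry.Lorentzian.InitialDataSet (𝓡 3) X), Literature.Geometry.Lorentzian.InitialDataSet.IsTameDataFamily e 1 F ∧ Literature.Geometry.Lorentzian.InitialDataSet.IsImmersedAtZero 1 F ∧ F 0 = D ∧ Function.Injective F ∧ (∀ c, F c ∈ Literature.Geometry.Lorentzian.admissibleVacuumData X) ∧ ∃ ε > (0 : ℝ), ∀ c, c ≠ 0 → ‖c‖ < ε → ∀ 𝒟 : Literature.Geometry.Lorentzian.VacuumCauchyDevelopment (F c), 𝒟.IsMaximal → Summit.FinalStateConjecture.HasCompleteNullInfinity 𝒟.toCauchyDevelopment ∧ ∀ (O : Set 𝒟.carrier) (d : Literature.Geometry.Lorentzian.FinalStateDecomposition 𝒟.toSpacetime O 0), O = Summit.FinalStateConjecture.exteriorOf 𝒟.toCauchyDevelopment d.charted → Summit.FinalStateConjecture.RaysStayInClosure 𝒟.toCauchyDevelopment O → Summit.FinalStateConjecture.HasExhaustiveCharts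 d → Summit.FinalStateConjecture.IsFutureOriented d → ∀ i, Literature.Geometry.Lorentzian.Kerr.IsSubextremal (d.mass i) (d.spin i) :=
  Iff.rfl

/-- Stub 3 IS its short form. [folklore] -/
theorem stub_censoredLanding_iff :
    Goal.stub_censoredLanding ↔
      ∀ (X : Type) [TopologicalSpace X] [ChartedSpace Literature.Geometry.Lorentzian.E3 X] [IsManifold (𝓡 3) (⊤ : ℕ∞) X] [T2Space X] [SecondCountableTopology X] [ConnectedSpace X], ∀ (e : Literature.Geometry.Lorentzian.AFEnd X) (F : EuclideanSpace ℝ (Fin 1) → Literature.Geometry.Lorentzian.InitialDataSet (𝓡 3) X), Literature.Geometry.Lorentzian.InitialDataSet.IsTameDataFamily e 1 F → Literature.Geometry.Lorentzian.InitialDataSet.IsImmersedAtZero 1 F → Function.Injective F → (∀ c, F c ∈ Literature.Geometry.Lorentzian.admissibleVacuumData X) → (∃ 𝒟 : Literature.Geometry.Lorentzian.VacuumCauchyDevelopment (F 0), 𝒟.IsMaximal ∧ ¬ Summit.FinalStateConjecture.HasCompleteNullInfinity 𝒟.toCauchyDevelopment) → (∀ c ≠ 0, ∀ 𝒟 : Literature.Geometry.Lorentzian.VacuumCauchyDevelopment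 (F c), 𝒟.IsMaximal → Summit.FinalStateConjecture.HasCompleteNullInfinity 𝒟.toCauchyDevelopment) → ∃ (e' : Literature.Geometry.Lorentzian.AFEnd X) (F' : EuclideanSpace ℝ (Fin 1) → Literature.Geometry.Lorentzian.InitialDataSet (𝓡 3) X), Literature.Geometry.Lorentzian.InitialDataSet.IsTameDataFamily e' 1 F' ∧ Literature.Geometry.Lorentzian.InitialDataSet.IsImmersedAtZero 1 F' ∧ F' 0 = F 0 ∧ Function.Injective F' ∧ (∀ c, F' c ∈ Literature.Geometry.Lorentzian.admissibleVacuumData X) ∧ ∃ ε > (0 : ℝ), ∀ c, c ≠ 0 → ‖c‖ < ε → ∀ 𝒟 : Literature.Geometry.Lorentzian.VacuumCauchyDevelopment (F' c), 𝒟.IsMaximal → Summit.FinalStateConjecture.HasCompleteNullInfinity 𝒟.toCauchyDevelopment ∧ ∀ (O : Set 𝒟.carrier) (d : Literature.Geometry.Lorentzian.FinalStateDecomposition 𝒟.toSpacetime O 0), O = Summit.FinalStateConjecture.exteriorOf 𝒟.toCauchyDevelopment d.charted → Summit.FinalStateConjecture.RaysStayInClosure 𝒟.toCauchyDevelopment O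 → Summit.FinalStateConjecture.HasExhaustiveCharts d → Summit.FinalStateConjecture.IsFutureOriented d → ∀ i, Literature.Geometry.Lorentzian.Kerr.IsSubextremal (d.mass i) (d.spin i) :=
  Iff.rfl

/-- Stub 1 IS the shared route item stmt-FinalStateConjecture-17269 (definitionally). [folklore] -/
theorem stub_weakCosmicCensorshipTame_iff_item17269 :
    Goal.stub_weakCosmicCensorshipTame ↔
      Summit.FinalStateConjecture.FinalStateConjecture.Theses.PhaseMixingCapture.WeakCosmicCensorshipTame :=
  Iff.rfl

theorem weakCosmicCensorshipTame_holds : Goal.stub_weakCosmicCensorshipTame :=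
  stub_weakCosmicCensorshipTame
theorem thresholdTransversality_holds : Goal.stub_thresholdTransversal := stub_thresholdTransversal
theorem censoredLanding_holds : Goal.stub_censoredLanding := stub_censoredLanding

/-! ## §4 The composition (sorry-free): the crux BY NAME from the three stubs -/

/-- **Tame genericity of `CENS ∧ THIRD` produced along censored curves.** At an exceptional admissible
`d`: if `d` is censored it has an extremal honest endpoint and Sub₂ gives a local escape; if not, some
MGHD of `d` has incomplete `𝓘⁺`, `d` is exceptional for Sub₁, whose witness curve is tame, immersed,
injective, admissible with censored members off `0` (read off the exceptional-set clause), and Sub₃ gives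
a local escape through `d`; the local escape is globalised by the radial reparametrisation
`InitialDataSet.isTameChristodoulouGeneric_of_local`. [folklore] -/
theorem genericCensorshipThirdLaw_of_pieces (hWCC : Goal.stub_weakCosmicCensorshipTame)
    (hThr : Goal.stub_thresholdTransversal) (hLand : Goal.stub_censoredLanding) :
    GenericCensorshipThirdLaw := by
  intro X _ _ _ _ _ _
  refine InitialDataSet.isTameChristodoulouGeneric_of_local ?_
  intro d hd hP
  by_cases hC : CensoredProperty d
  · -- censored datum: it has an extremal honest C⁰ endpoint; Sub₂ escapes locally
    exact hThr X d hd hC (hasExtremalHonestEndpoint_of_censored_not_cruxProperty hC hP)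
  · -- non-censored datum: exceptional for tame weak cosmic censorship
    obtain ⟨e, F, hF, himm, h0, hinj, h𝓓, hE⟩ := hWCC X d ⟨hd, fun h ↦ hC h.2⟩
    have hcens : ∀ c ≠ 0, CensoredProperty (F c) := by
      intro c hc
      by_contra hneg
      exact hE c hc ⟨h𝓓 c, fun h ↦ hneg h.2⟩
    subst h0
    exact hLand X e F hF himm hinj h𝓓 (exists_incomplete_of_not_censored hC) hcens

/-- **The crux BY NAME (TwoBoundarySqueeze copy) from the registered stubs.** -/
theorem GenericCensorshipThirdLaw_of :
    Goal.stub_weakCosmicCensorshipTame → Goal.stub_thresholdTransversal → Goal.stub_censoredLanding →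
      Summit.FinalStateConjecture.FinalStateConjecture.Theses.TwoBoundarySqueeze.GenericCensorshipThirdLaw :=
  genericCensorshipThirdLaw_of_pieces

/-- **Skeleton conclusion in the registry's shape** (interim: the TwoBoundarySqueeze copy of the shared item's decl;
`ledger skeleton check … --crux-decl Summit.FinalStateConjecture.FinalStateConjecture.Theses.TwoBoundarySqueeze.GenericCensorshipThirdLaw`). -/
theorem GenericCensorshipThirdLaw_proof :
    Summit.FinalStateConjecture.FinalStateConjecture.Theses.TwoBoundarySqueeze.GenericCensorshipThirdLaw :=
  GenericCensorshipThirdLaw_of stub_weakCosmicCensorshipTame stub_thresholdTransversal stub_censoredLanding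

/-- The same, under the v1 name. -/
theorem genericCensorshipThirdLaw_of_stubs :
    Summit.FinalStateConjecture.FinalStateConjecture.Theses.TwoBoundarySqueeze.GenericCensorshipThirdLaw :=
  GenericCensorshipThirdLaw_of stub_weakCosmicCensorshipTame stub_thresholdTransversal stub_censoredLanding

/-! ## §5 Records: no stub over-claims (each is a consequence of the crux, Sub₁ given `MGHDExists`),
so with the route's rank-9 item the cut `Sub₁ ∧ Sub₂ ∧ Sub₃ ⟹ crux` is LOSSLESS. -/

/-- Sub₂ ⟸ crux: at a censored datum with an extremal honest endpoint the crux's own witness serves,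
`ε = 1`. [folklore] -/
theorem thresholdTransversality_of_crux (hG : GenericCensorshipThirdLaw) :
    Goal.stub_thresholdTransversal := by
  intro X _ _ _ _ _ _ d hd _hC hT
  have hP : ¬ CruxProperty d := fun hP ↦
    ((hasExtremalHonestEndpoint_iff_not_thirdLaw d).1 hT) ((cruxProperty_iff d).1 hP).2
  obtain ⟨e, F, hF, himm, h0, hinj, h𝓓, hE⟩ := hG X d ⟨hd, hP⟩
  refine ⟨e, F, hF, himm, h0, hinj, h𝓓, 1, one_pos, fun c hc _ ↦ ?_⟩
  by_contra hneg
  exact hE c hc ⟨h𝓓 c, hneg⟩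

/-- Sub₃ ⟸ crux: the base of the given curve is not censored, hence exceptional; the crux's own witness
through it serves, `ε = 1`. [folklore] -/
theorem censoredLanding_of_crux (hG : GenericCensorshipThirdLaw) : Goal.stub_censoredLanding := by
  intro X _ _ _ _ _ _ e F _hF _himm _hinj h𝓓 hV _hcens
  have hP : ¬ CruxProperty (F 0) := by
    rintro hP
    obtain ⟨𝒟, h𝒟, hI⟩ := hV
    exact hI (hP 𝒟 h𝒟).1
  obtain ⟨e', F', hF', himm', h0', hinj', h𝓓', hE⟩ := hG X (F 0) ⟨h𝓓 0, hP⟩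
  refine ⟨e', F', hF', himm', h0', hinj', h𝓓', 1, one_pos, fun c hc _ ↦ ?_⟩
  by_contra hneg
  exact hE c hc ⟨h𝓓' c, hneg⟩

/-- Sub₁ ⟸ crux ∧ MGHD existence (`IsTameChristodoulouGeneric.mono`). [folklore] -/
theorem weakCosmicCensorshipTame_of_crux_of_mghdExists (hG : GenericCensorshipThirdLaw)
    (hM : MGHDExists) : Goal.stub_weakCosmicCensorshipTame := by
  intro X _ _ _ _ _ _
  exact (hG X).mono fun D hD hP ↦ ⟨hM X D hD, fun 𝒟 h𝒟 ↦ (hP 𝒟 h𝒟).1⟩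

/-- LOSSLESSNESS given `MGHDExists`: the crux is equivalent to the conjunction of the three stubs. (An
equivalence with the CONJUNCTION, not with any single stub: each stub alone fails the cheap probes
`stub → crux`, `stub → FinalStateConjecture`, recorded in the strategist's bc/ files.) [folklore] -/
theorem genericCensorshipThirdLaw_iff_pieces (hM : MGHDExists) :
    GenericCensorshipThirdLaw ↔
      Goal.stub_weakCosmicCensorshipTame ∧ Goal.stub_thresholdTransversal ∧ Goal.stub_censoredLanding :=
  ⟨fun hG ↦ ⟨weakCosmicCensorshipTame_of_crux_of_mghdExists hG hM, thresholdTransversality_of_crux hG,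
      censoredLanding_of_crux hG⟩,
    fun h ↦ genericCensorshipThirdLaw_of_pieces h.1 h.2.1 h.2.2⟩

end Summit.FinalStateConjecture.FinalStateConjecture.Cruxes.GenericCensorshipThirdLaw.CensoredCurvesSplit

end
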